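import Mathlib.LinearAlgebra.Determinant
import Mathlib.LinearAlgebra.Dual.Lemmas
import Mathlib.LinearAlgebra.FiniteDimensional.Basic
import Mathlib.RingTheory.Nakayama
import Mathlib.RingTheory.LocalRing.MaximalIdeal.Basic
import Mathlib.RingTheory.Ideal.Quotient.Basic
import Mathlib.Algebra.Module.Torsion.Basic
import Mathlib.GroupTheory.OrderOfElement
import Mathlib.Tactic.Abel
import Mathlib.Tactic.Ring
import HarnessLib

/-!
# Ribet's multiplicity-one mechanism (Invent. Math. 100 (1990), proof of Theorem 6.4) as pure algebra: a 2-dimensional `𝔪`-torsion, a Frobenius acting by a scalar on the toric line, and `q ≢ 1` give `dim X/𝔪X ≤ 1`, hence `X_𝔪` free of rank one (cell `b2b-bsdres`, seat additive-p4 gen 43, memo V76 §1 — K126)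

HONEST FRAMING (verbatim, cell `b2b-bsdres`): the goal of the cell is to DELETE the COMBINATION-SHAPED
residual classes for ALL analytic-rank `≤ 1` curves over `ℚ` — "full BSD formula for every rank `≤ 1`
curve in class `C`" assembled STRICTLY from published theorems — so that the rank-`≤ 1` remainder
becomes exactly the CONSTRUCTION-SHAPED classes, which are TYPED (missing-input Props), NOT attempted;
this is not "finishing BSD". This file: TOOL theorems (pure linear / commutative algebra; 0 defs, 0 facts,
nothing booked; X4 stays CONSTRUCTION-shaped; no mark moves).

## Why

Three leaves of the θ-rows' END STATE (THETA-ROWS-ENDSTATE §2) are quaternionic / toric MULTIPLICITY-ONE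
statements of the shape "the character group `X` of the toric part at `q` of a modular abelian variety,
localised at the non-Eisenstein maximal ideal `𝔪` of residue characteristic `ℓ = 3`, is free of rank one
over the Hecke algebra acting on it": (MO^D) at `3`-free Eichler level [PUB: Ribet 1990 Thm 6.4],
(MO^D) at the ORDINARY ideals of `3`-divisible level [so far SKETCH: "Ribet's Thm 6.4 ARGUMENT run on
Wiles 1995 Thm 2.1(ii)", THETA §5 (vi)], and (MO^θ) for the syntheme module `S₀` [so far CERT + SKETCH:
memo V74 §2 (iii), "(MO_Q) + `ℓ₂ ≢ 1 (mod 3)` ⟹ (MO^θ) by Ribet's printed mechanism"]. Ribet's printed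
proof (p. 471; pin THETA §6.8) is one paragraph of ALGEBRA once its inputs are named:

  "Since `ℓ` is prime to `N = pM`, (5.2b) implies that `V = J₀(N)[𝔪]` is a two-dimensional `𝕋/𝔪`-vector
  space which gives the representation `ρ_𝔪`. Since `Hom(X/𝔪X, μ_ℓ)` is a subspace of `V` (considered
  as a `𝕋/𝔪[D]`-module), `X/𝔪X` is of dimension `≤ 2`. If `X/𝔪X` is of dimension `2`, then we get the
  equality `V = Hom(X/𝔪X, μ_ℓ)`. Arguing as above [`D = D_p` acts on `Hom(X/𝔪X, μ_ℓ)` through `εχ`,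
  `ε` unramified quadratic — Frobenius acts on `X` as `T_p = −w_p = ±1` —, and `det V = χ`], we get
  the congruence `p ≡ 1 (mod ℓ)`. This is contrary to our assumption about `ℓ`."

This file proves exactly that paragraph, and the two standard steps after it (Nakayama: `dim X/𝔪X ≤ 1`
⟹ `X_𝔪` cyclic; cyclic + faithful ⟹ free of rank one), for ANY field `k` (for `𝕋/𝔪`), `k`-space `V`
(for `J[𝔪]` or `Q[𝔪]`), endomorphism `F` (for `Frob_q`), scalars `e, q ∈ k` (for `∓w_q` and `q mod ℓ`),
`k`-space `X̄` (for `X/𝔪X`) with an injective `k`-linear map `Module.Dual k X̄ → V` on whose image `F`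
acts as `e*q` (for `Hom(X/𝔪X, μ_ℓ) ↪ J[𝔪]`, SGA7 IX / Grothendieck's orthogonality), and any local ring
`R` (for `𝕋_𝔪`) with a finitely generated faithful module `X` (for `X_𝔪`):

* `finrank_le_one_of_scalar_action_of_det_ne_sq` — `dim V = 2`, `F = c` on `W ≤ V`, `det F ≠ c²` ⟹
  `dim W ≤ 1`;
* `finrank_le_one_of_frobenius_data` — the same with Ribet's numbers: `F = e q` on `W`, `e² = 1`,
  `det F = q`, `q ≠ 0`, `q ≠ 1` in `k` (i.e. `ℓ ∤ q(q − 1)`) ⟹ `dim W ≤ 1`; and `eq_one_of_finrank_eq_two`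
  — the contrapositive AS PRINTED: `dim W = 2` forces `q = 1` in `k` ("`p ≡ 1 (mod ℓ)`");
* `finrank_le_one_of_dual_embedding` — transported to `X̄` through an injective `Module.Dual k X̄ →ₗ V`;
* `exists_span_singleton_eq_top_of_generator_mod` / `…_of_finrank_quotient_le_one` — NAKAYAMA: over a
  commutative ring with `I ≤ Jac(0)` (resp. a local ring and `I = 𝔪`), a finitely generated module
  generated by one element modulo `I` (resp. with `dim_{R/𝔪} X/𝔪X ≤ 1`) is CYCLIC;
* `nonempty_linearEquiv_of_cyclic_of_faithful` — a cyclic FAITHFUL module over a commutative ring is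
  free of rank one (`X ≃ₗ[R] R`);
* `nonempty_linearEquiv_of_ribetData` — **THEOREM 6.4 IN KERNEL FORM**: all of the above composed; the
  displayed hypotheses are exactly (MO) "`dim_k V = 2`", the toric embedding with its Frobenius scalar,
  `det F = q`, `e² = 1`, `q ≠ 0, 1` in `k`, `X` finitely generated and faithful over the local `R` —
  conclusion `X ≃ₗ[R] R`;
* `zpow_sq_ne_self_of_even_orderOf` — the one-line group fact behind memo V74 §3 ("`D_p`-distinguished is
  automatic for reducible `E[p]|_{G_{ℚ_p}}`, `p` odd"): an element of EVEN order is not the square of any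
  of its own powers (characters of `G_{ℚ_p}` restrict to inertia inside `⟨ω⟩`, `ω` of order `p − 1`;
  `ψ₁ = ψ₂` with `ψ₁ψ₂ = ω` on inertia would make `ω` such a square).

APPLICATIONS (displayed THERE, not here; nothing is identified in this file): (1) Ribet 1990 Thm 6.4
itself (`V = J₀(qL)[𝔪]`, (5.2b)); (2) the ordinary leaf of THETA §2 (a′): `V = J₀(3M)[𝔪̃_±]` of dimension 2
by Wiles 1995 Thm 2.1(ii) (its `D₃`-distinguishedness hypothesis automatic by the last bullet), `X` the
character group at `q = ℓ₂` of Eichler level divisible by `3`; (3) (MO^θ) ⟸ (MO_Q): `V = Q[𝔪]` for the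
θ-new quotient `Q` of `Jac(X(Γ₀(ℓ₂L) ∩ Γ⁺_ns(3)))` [(MO_Q): CERT E20 P-MOQ 18/18, census 1664/1664],
`X = X(T_Q) = S₀(L)` at `𝔪` [memo V74 §2 (ii)]. In all three `q = ℓ₂ ≢ 1 (mod 3)`, `e = ∓1 = T_{ℓ₂}` on
the `ℓ₂`-new lattice, `det ρ̄ = χ₃`. Which `V`, `X`, `F` an application uses, and why its embedding
hypothesis holds (SGA7 IX 11.6 / Ribet 1990 (3.6)–(3.7)), is displayed there; X4 stays CONSTRUCTION-shaped.

## References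

* K. A. Ribet, «On modular representations of Gal(ℚ̄/ℚ) arising from modular forms», Invent. Math. 100
  (1990) 431–476: Thm 6.4 p. 471 and its proof; Prop. 3.7–3.8 pp. 446–447 (Frobenius on `X` is `T_q = −w_q`).
  [cite: Ribet1990, Thm 6.4]
* A. Wiles, Ann. of Math. 141 (1995), Thm 2.1 (ii) (the ordinary application). [cite: Wiles1995Annals, Thm 2.1]
* A. Grothendieck, SGA 7 I, exp. IX, §11 (toric part of the `ℓ`-torsion) — context for the embedding hypothesis.
-/

namespace Summit.BirchSwinnertonDyer.Rank1Residual.LevelLowering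

open Module

/-! ## §1. The determinant count (Ribet 1990, proof of Thm 6.4, last four sentences) -/

section DeterminantCount

variable {k V : Type*} [Field k] [AddCommGroup V] [Module k V] [FiniteDimensional k V]

/-- If `V` is `2`-dimensional, `F` acts on the subspace `W` as the scalar `c`, and `det F ≠ c²`, then
`dim W ≤ 1`. (If `dim W = 2` then `W = V`, `F = c·1`, `det F = c²`.) -/
theorem finrank_le_one_of_scalar_action_of_det_ne_sq (F : V →ₗ[k] V) (W : Submodule k V) (c : k)
    (hV : finrank k V = 2) (hW : ∀ w ∈ W, F w = c • w) (hdet : LinearMap.det F ≠ c ^ 2) :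
    finrank k W ≤ 1 := by
  by_contra h
  have hle : finrank k W ≤ 2 := hV ▸ Submodule.finrank_le W
  have h2 : finrank k W = finrank k V := by omega
  have htop : W = ⊤ := Submodule.eq_top_of_finrank_eq h2
  have hF : F = c • LinearMap.id := by
    ext v
    simpa using hW v (htop ▸ Submodule.mem_top)
  apply hdet
  rw [hF, LinearMap.det_smul, LinearMap.det_id, mul_one, hV]

/-- Ribet's numbers: Frobenius acts on the toric line as `e·q` with `e = ±1` (`e² = 1`; `e = −w_q = T_q`
on `X`, times the cyclotomic `q` on `μ_ℓ`), `det F = q` (`det ρ̄ = χ_ℓ`), and `q ≠ 0`, `q ≠ 1` in `k`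
(`ℓ ∤ q`, `q ≢ 1 (mod ℓ)`). Then the toric subspace has dimension `≤ 1`. -/
theorem finrank_le_one_of_frobenius_data (F : V →ₗ[k] V) (W : Submodule k V) (e q : k)
    (hV : finrank k V = 2) (hW : ∀ w ∈ W, F w = (e * q) • w) (he : e ^ 2 = 1)
    (hdet : LinearMap.det F = q) (hq0 : q ≠ 0) (hq1 : q ≠ 1) :
    finrank k W ≤ 1 := by
  refine finrank_le_one_of_scalar_action_of_det_ne_sq F W (e * q) hV hW ?_
  rw [hdet, mul_pow, he, one_mul, sq]
  intro h
  exact hq1 (mul_left_cancel₀ hq0 (by rw [mul_one]; exact h.symm))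

/-- The contrapositive AS PRINTED ("If `X/𝔪X` is of dimension `2` … we get the congruence `p ≡ 1 (mod ℓ)`"):
with Ribet's numbers and `q ≠ 0` in `k`, a `2`-dimensional toric subspace forces `q = 1` in `k`. -/
theorem eq_one_of_finrank_eq_two (F : V →ₗ[k] V) (W : Submodule k V) (e q : k)
    (hV : finrank k V = 2) (hW : ∀ w ∈ W, F w = (e * q) • w) (he : e ^ 2 = 1)
    (hdet : LinearMap.det F = q) (hq0 : q ≠ 0) (h2 : finrank k W = 2) : q = 1 := by
  by_contra hq1
  have := finrank_le_one_of_frobenius_data F W e q hV hW he hdet hq0 hq1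
  omega

/-- Transport along an injective linear map: if `F` acts as `c` on the image of the injective `i : D → V`,
`dim V = 2` and `det F ≠ c²`, then `dim D ≤ 1`. -/
theorem finrank_le_one_of_injective_of_scalar_action {D : Type*} [AddCommGroup D] [Module k D]
    [FiniteDimensional k D] (i : D →ₗ[k] V) (hi : Function.Injective i) (F : V →ₗ[k] V) (c : k)
    (hV : finrank k V = 2) (hF : ∀ d : D, F (i d) = c • i d) (hdet : LinearMap.det F ≠ c ^ 2) :
    finrank k D ≤ 1 := by
  have h := finrank_le_one_of_scalar_action_of_det_ne_sq F (LinearMap.range i) c hV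
    (by rintro w ⟨d, rfl⟩; exact hF d) hdet
  rwa [LinearMap.finrank_range_of_inj hi] at h

/-- The toric line is a DUAL: `Hom(X/𝔪X, μ_ℓ) ≅ Module.Dual k X̄` (`μ_ℓ ≅ k` as a line). If it embeds in the
`2`-dimensional `V` with Frobenius scalar `e·q`, `e² = 1`, `det F = q`, `q ≠ 0, 1`, then `dim X̄ ≤ 1`. -/
theorem finrank_le_one_of_dual_embedding {Xbar : Type*} [AddCommGroup Xbar] [Module k Xbar]
    [FiniteDimensional k Xbar] (i : Module.Dual k Xbar →ₗ[k] V) (hi : Function.Injective i)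
    (F : V →ₗ[k] V) (e q : k) (hV : finrank k V = 2)
    (hF : ∀ φ : Module.Dual k Xbar, F (i φ) = (e * q) • i φ) (he : e ^ 2 = 1)
    (hdet : LinearMap.det F = q) (hq0 : q ≠ 0) (hq1 : q ≠ 1) :
    finrank k Xbar ≤ 1 := by
  have hne : LinearMap.det F ≠ (e * q) ^ 2 := by
    rw [hdet, mul_pow, he, one_mul, sq]
    intro h
    exact hq1 (mul_left_cancel₀ hq0 (by rw [mul_one]; exact h.symm))
  have h := finrank_le_one_of_injective_of_scalar_action i hi F (e * q) hV hF hne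
  rwa [Subspace.dual_finrank_eq] at h

end DeterminantCount

/-! ## §2. Nakayama: one generator modulo `𝔪` gives a cyclic module -/

section Nakayama

variable {R X : Type*} [CommRing R] [AddCommGroup X] [Module R X]

/-- NAKAYAMA, cyclic case: if `I ≤ Jac(0)` (e.g. `R` local, `I = 𝔪`), `X` is finitely generated and some
`x` generates `X` modulo `I • X`, then `x` generates `X`. -/
theorem exists_span_singleton_eq_top_of_generator_mod [Module.Finite R X] (I : Ideal R)
    (hI : I ≤ (⊥ : Ideal R).jacobson) (x : X)
    (hx : ∀ y : X, ∃ r : R, y - r • x ∈ I • (⊤ : Submodule R X)) :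
    Submodule.span R {x} = ⊤ := by
  refine top_le_iff.mp (Submodule.le_of_le_smul_of_le_jacobson_bot Module.Finite.fg_top hI ?_)
  intro y _
  obtain ⟨r, hr⟩ := hx y
  have : y = r • x + (y - r • x) := by abel
  rw [this]
  exact Submodule.add_mem_sup (Submodule.smul_mem _ r (Submodule.subset_span rfl)) hr

/-- The same from the residue-field dimension: over a local ring `R` with maximal ideal `𝔪`, a finitely
generated `X` with `dim_{R/𝔪} (X/𝔪X) ≤ 1` is cyclic. -/
theorem exists_span_singleton_eq_top_of_finrank_quotient_le_one [IsLocalRing R] [Module.Finite R X]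
    (h : finrank (R ⧸ IsLocalRing.maximalIdeal R)
      (X ⧸ (IsLocalRing.maximalIdeal R) • (⊤ : Submodule R X)) ≤ 1) :
    ∃ x : X, Submodule.span R {x} = ⊤ := by
  haveI : (IsLocalRing.maximalIdeal R).IsMaximal := IsLocalRing.maximalIdeal.isMaximal R
  letI : Field (R ⧸ IsLocalRing.maximalIdeal R) := Ideal.Quotient.field _
  haveI : Module.Free (R ⧸ IsLocalRing.maximalIdeal R)
      (X ⧸ (IsLocalRing.maximalIdeal R) • (⊤ : Submodule R X)) := Module.Free.of_divisionRing _ _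
  set 𝔪 := IsLocalRing.maximalIdeal R
  obtain ⟨v, hv⟩ := finrank_le_one_iff.mp h
  obtain ⟨x, rfl⟩ := Submodule.Quotient.mk_surjective _ v
  refine ⟨x, exists_span_singleton_eq_top_of_generator_mod 𝔪
    (IsLocalRing.maximalIdeal_le_jacobson _) x fun y => ?_⟩
  obtain ⟨c, hc⟩ := hv (Submodule.Quotient.mk y)
  obtain ⟨r, rfl⟩ := Ideal.Quotient.mk_surjective c
  refine ⟨r, ?_⟩
  rw [← Submodule.Quotient.mk_eq_zero, Submodule.Quotient.mk_sub, ← hc]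
  exact sub_eq_zero.mpr rfl

end Nakayama

/-! ## §3. Cyclic and faithful ⟹ free of rank one -/

section CyclicFaithful

variable {R X : Type*} [CommRing R] [AddCommGroup X] [Module R X]

/-- A cyclic FAITHFUL module over a commutative ring is free of rank one: `r ↦ r • x` is an isomorphism
`R ≃ X` (surjective because `x` generates, injective because an `r` killing `x` kills `X = Rx`). -/
theorem nonempty_linearEquiv_of_cyclic_of_faithful (x : X) (hx : Submodule.span R {x} = ⊤)
    (hfaith : ∀ r : R, (∀ y : X, r • y = 0) → r = 0) : Nonempty (X ≃ₗ[R] R) := by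
  have hsurj : Function.Surjective (LinearMap.toSpanSingleton R X x) := by
    rw [← LinearMap.range_eq_top, ← LinearMap.span_singleton_eq_range, hx]
  have hinj : Function.Injective (LinearMap.toSpanSingleton R X x) := by
    rw [← LinearMap.ker_eq_bot, Submodule.eq_bot_iff]
    intro r hr
    rw [LinearMap.mem_ker, LinearMap.toSpanSingleton_apply] at hr
    refine hfaith r fun y => ?_
    obtain ⟨s, rfl⟩ := hsurj y
    rw [LinearMap.toSpanSingleton_apply, smul_smul, mul_comm, ← smul_smul, hr, smul_zero]
  exact ⟨(LinearEquiv.ofBijective _ ⟨hinj, hsurj⟩).symm⟩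

end CyclicFaithful

/-! ## §4. Theorem 6.4 in kernel form -/

section RibetSixFour

variable {R : Type*} [CommRing R] [IsLocalRing R]
variable {X : Type*} [AddCommGroup X] [Module R X] [Module.Finite R X]

/-- **RIBET 1990, THEOREM 6.4 — KERNEL FORM.** Let `R` be a local ring (`𝕋_𝔪`) with residue field
`k = R/𝔪`, `X` a finitely generated FAITHFUL `R`-module (the character group `X_𝔪`), `X̄ = X/𝔪X`. Suppose
given a `2`-dimensional `k`-space `V` (`J[𝔪] ≅ ρ̄`, resp. `Q[𝔪]`: (MO) / (5.2b) / Wiles 2.1(ii) / (MO_Q)),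
an endomorphism `F` of `V` (Frobenius at `q`) with `det F = q` (`det ρ̄ = χ`), an injective `k`-linear
`i : Module.Dual k X̄ → V` (the toric `𝔪`-torsion `Hom(X/𝔪X, μ_ℓ) ⊂ J[𝔪]`) on which `F` acts as `e·q`
(`e = T_q = −w_q` on `X`, `e² = 1`), and `q ≠ 0`, `q ≠ 1` in `k` (`ℓ ∤ q`, `q ≢ 1 (mod ℓ)`). Then `X` is
free of rank one over `R`. Displayed hypotheses only; no number theory enters. -/
theorem nonempty_linearEquiv_of_ribetData
    (hfaith : ∀ r : R, (∀ y : X, r • y = 0) → r = 0)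
    {V : Type*} [AddCommGroup V] [Module (R ⧸ IsLocalRing.maximalIdeal R) V]
    [Module.Finite (R ⧸ IsLocalRing.maximalIdeal R) V]
    (hV : finrank (R ⧸ IsLocalRing.maximalIdeal R) V = 2)
    (F : V →ₗ[R ⧸ IsLocalRing.maximalIdeal R] V) (e q : R ⧸ IsLocalRing.maximalIdeal R)
    (he : e ^ 2 = 1) (hdet : LinearMap.det F = q) (hq0 : q ≠ 0) (hq1 : q ≠ 1)
    (i : Module.Dual (R ⧸ IsLocalRing.maximalIdeal R)
        (X ⧸ (IsLocalRing.maximalIdeal R) • (⊤ : Submodule R X)) →ₗ[R ⧸ IsLocalRing.maximalIdeal R] V)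
    (hi : Function.Injective i)
    (hF : ∀ φ, F (i φ) = (e * q) • i φ) :
    Nonempty (X ≃ₗ[R] R) := by
  haveI : (IsLocalRing.maximalIdeal R).IsMaximal := IsLocalRing.maximalIdeal.isMaximal R
  letI : Field (R ⧸ IsLocalRing.maximalIdeal R) := Ideal.Quotient.field _
  have h1 := finrank_le_one_of_dual_embedding i hi F e q hV hF he hdet hq0 hq1
  obtain ⟨x, hx⟩ := exists_span_singleton_eq_top_of_finrank_quotient_le_one (R := R) (X := X) h1
  exact nonempty_linearEquiv_of_cyclic_of_faithful x hx hfaith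

end RibetSixFour

/-! ## §5. The group fact behind "`D_p`-distinguished is automatic" (memo V74 §3) -/

section Distinguished

variable {G : Type*} [Group G]

/-- An element `ω` of EVEN order is not the square of any of its own powers: `(ω^a)² ≠ ω` (for
`orderOf ω = 0`, i.e. infinite order, the hypothesis `Even 0` holds and the conclusion is still true).
Application (memo V74 §3, THETA §5 (vi)): characters `G_{ℚ_p} → k^×` restrict to inertia inside the cyclic
group generated by `ω|_{I_p}` (order `p − 1`, even for odd `p`); if `ρ̄|_{G_{ℚ_p}} ≅ (ψ₁ * ; 0 ψ₂)` had
`ψ₁ = ψ₂ = ψ` then `ω|_{I_p} = (ψ₁ψ₂)|_{I_p} = (ψ|_{I_p})²` with `ψ|_{I_p} = ω^a` — impossible; so the two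
diagonal characters are distinct, i.e. Wiles' "`D_p`-distinguished" hypothesis holds. -/
theorem zpow_sq_ne_self_of_even_orderOf (ω : G) (hω : Even (orderOf ω)) (a : ℤ) :
    (ω ^ a) ^ 2 ≠ ω := by
  intro h
  rw [sq] at h
  have h1 : ω ^ (a + a - 1) = 1 := by
    rw [zpow_sub_one, zpow_add, h, mul_inv_cancel]
  have hdvd : (orderOf ω : ℤ) ∣ a + a - 1 := orderOf_dvd_iff_zpow_eq_one.mpr h1
  obtain ⟨m, hm⟩ := hω
  have h2 : (2 : ℤ) ∣ (orderOf ω : ℤ) := ⟨m, by rw [hm]; push_cast; ring⟩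
  have h3 := dvd_trans h2 hdvd
  omega

end Distinguished

end Summit.BirchSwinnertonDyer.Rank1Residual.LevelLowering
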